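import Summits.AtomisticToContinuum.HydrodynamicLimit.Theorems.AntiMazurCoboundariesKineticFluxLdDecayHTheoremObjectsD
import HarnessLib

/-!
# Objects of the crux line `h-theorem-dissipation-budget`, part E: THE RATE IS IDLE TOO — the weakest core the
# composition accepts, and the statements that pin it to the crux (crux `KineticFluxLdDecay`,
# stmt-AtomisticToContinuum-10967; lead c5, reshape 4)

Why a part E. After part D the one open stub of the line is the `A`-free large-window core
`LargeWindowDissipationTilt`: the TOTAL cut Hellinger production of the optimal enemy `G_N^X` over the window
`h = τ(N+1)^{-1/3}` is `≤ (h/τ)·B`, i.e. the window-AVERAGED production decays at the RATE `B/τ`. The landed reduction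
(`Theorems/…HTheoremReduction.lean`, p140516) never uses the rate: after AM–GM `√d ≤ d/(2r) + r/2` the production enters
linearly, so the composition only needs the window-averaged cut production of `G_N^X` to be SMALL at some window. This
part types that weaker core and the three elementary statements through which it is compared with the crux itself:

* `VanishingWindowDissipationTilt` — **the core of reshape 4**: for admissible `φ, g`, every cut `K ≥ 1` and every
  `η > 0` there are a window `τ > 0` and `N₀` with `∫₀ʰ 𝒟(cut one-body density of G_N^X at t) dt ≤ η·h` for all
  `N ≥ N₀` and every flow (quantifier shape of the crux: one good window per tolerance). Implied by
  `LargeWindowDissipationTilt` (`HTheoremObjectsEBasic`, proved below: take `τ > max(τ₀, B/η)`).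
* `TiltEntropyVanishing` — **the optimal enemy is entropically negligible**: for admissible `φ, g` and every `ε > 0`
  there are `τ > 0`, `N₀` with `KL(G_N^X ‖ G_N) ≤ ε(N+1)` for `N ≥ N₀` and every flow. The crux implies it at half
  amplitude (Donsker–Varadhan at `2X` against the tilted law, `log E_G e^X ≥ 0` by centring), and it implies the core
  through the next two statements and the landed `VelocityEntropyBudget`.
* `SecondMomentBudget` — **entropy budgets the second velocity moment of the reduced one-body law**:
  `∫ ‖w‖² df_t ≤ c₂ + 4·KL(ν ‖ G_N)/(N+1)` (Donsker–Varadhan with the one-body tests `min(‖w‖², n)/4 − log Z_n`,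
  `Z_∞ = ∫ e^{‖w‖²/4} dγ = 2^{3/2}`; twin of the landed `FirstMomentBudget`, p150392).
* `ProductionContinuity` — **the cut Hellinger production is continuous at the Maxwellian in entropy**: for every cut
  `K`, second-moment bound `M` and `ε > 0` there is `η > 0` such that every one-body probability law `f ≪ vol ⊗ γ` with
  `∫ ‖w‖² df ≤ M` and `KL(f ‖ f₁ ⊗ γ) ≤ η` has cut production `≤ ε` (fibrewise `ζ = √ρ − √n`: the defect is
  `≤ 2(√(ρ'ρ'_*) − n)² + 2(√(ρρ_*) − n)²`, gain half = loss half by the collision involution,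
  `(√(ρρ_*) − n)² ≤ 2ζ²ρ_* + 2nζ_*²`, `B ≤ ‖v‖ + ‖v_*‖`, velocity truncation at radius `R`, `ζ² ≤ ρ + n`,
  `∫∫ ζ² ≤ KL(f ‖ f₁ ⊗ γ)` (tree `lintegral_sqrt_rnDeriv_sub_sqrt_fst_sq_le_klDiv`, p140153), and the fibres where
  `∫ ζ² dγ > λ n` carry `f₁`-mass `≤ KL/λ`). A TRUE `∀f` instantaneous statement, like `CutProductionLeMoment`.

With these, the skeleton of reshape 4 assembles (sorry-free below its stubs) `VanishingWindowDissipationTilt ↔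
KineticFluxLdDecay` and `TiltEntropyVanishing ↔ KineticFluxLdDecay`: the weakest core this line's architecture accepts
is a normal form of the crux, while the rate-bearing cores (`LargeWindowDissipationTilt`, `NoPerpetualDissipationTilt`)
are the crux WITH a window rate.
-/

noncomputable section

open MeasureTheory ProbabilityTheory Set Filter InformationTheory
open scoped ENNReal

namespace Summit.AtomisticToContinuum.HydrodynamicLimit.Theorems.HTheorem

open Literature.MathematicalPhysics.KineticTheory (T3 V3 hsDiameter localGibbsLaw)
open Literature.Analysis.FluidPDE (HardSphereFlow Config)

/-- Statement of `stub_vanishingWindowDissipationTilt` — **the core of reshape 4 (the weakest statement the landed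
H-theorem reduction accepts).** For constant profiles `(a, θ, u₀)` and small reduced density `σ < σ₀` there is an
amplitude `κ_b > 0` such that for all continuous `|φ| ≤ 1`, `|g| ≤ κ_b` with `g ⊥ span{1, v, |v|²}`, every cut level
`K ≥ 1` and every tolerance `η > 0` there are a kinetic window `τ > 0` and `N₀` such that for all `N ≥ N₀` and every
flow the time-integrated Hellinger production of the cut reduced one-body density of the tilted law `G_N^X` over the
window `h = τ(N+1)^{-1/3}` is at most `η·h`: the window-AVERAGED cut dissipation of the crux's optimal enemy is small at
some window (no rate). `LargeWindowDissipationTilt` (rate `B/τ`) implies it; the crux is equivalent to it. -/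
def VanishingWindowDissipationTilt : Prop :=
  ∀ (a θ : ℝ) (u₀ : V3), 0 < a → 0 < θ → ∃ σ₀ : ℝ, 0 < σ₀ ∧ ∀ σ : ℝ, 0 < σ → σ < σ₀ →
    ∃ κb : ℝ, 0 < κb ∧ ∀ (φ : T3 → ℝ) (g : V3 → ℝ), Continuous φ → Continuous g →
      (∀ x, |φ x| ≤ 1) → (∀ w, |g w| ≤ κb) → Orthogonal g →
      ∀ K : ℝ, 1 ≤ K → ∀ η : ℝ, 0 < η → ∃ τ : ℝ, 0 < τ ∧ ∃ N₀ : ℕ, ∀ N : ℕ, N₀ ≤ N →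
        ∀ Φ : Flow σ N,
          ∫⁻ t in Set.Ioo 0 (window τ N),
              production (cutDensity K θ u₀ Φ (tiltedGibbs σ a θ u₀ φ g τ N Φ) t) ≤
            ENNReal.ofReal (η * window τ N)

/-- Statement compared with the crux by `stub_tiltEntropyVanishing_of_crux` / `stub_vanishing_of_tiltEntropy` —
**the optimal enemy is entropically negligible.** For constant profiles `(a, θ, u₀)` and small reduced density
`σ < σ₀` there is an amplitude `κ > 0` such that for all continuous `|φ| ≤ 1`, `|g| ≤ κ` with `g ⊥ span{1, v, |v|²}`
and every `ε > 0` there are a kinetic window `τ > 0` and `N₀` with `KL(G_N^X ‖ G_N) ≤ ε (N+1)` for all `N ≥ N₀` and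
every flow, `G_N^X` the tilted law of the window `h = τ(N+1)^{-1/3}`. (From the crux at amplitude `2κ`:
`2 E_{G^X} X ≤ KL + log E_G e^{2X}` and `E_{G^X} X = KL + log E_G e^X ≥ KL`; conversely it gives the crux by
`E_{G^X} X ≤ (N+1)·2κ √(KL/(N+1))`, Hellinger ≤ Kullback for `f_t` against `(f_t)₁ ⊗ γ`.) -/
def TiltEntropyVanishing : Prop :=
  ∀ (a θ : ℝ) (u₀ : V3), 0 < a → 0 < θ → ∃ σ₀ : ℝ, 0 < σ₀ ∧ ∀ σ : ℝ, 0 < σ → σ < σ₀ →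
    ∃ κ : ℝ, 0 < κ ∧ ∀ (φ : T3 → ℝ) (g : V3 → ℝ), Continuous φ → Continuous g →
      (∀ x, |φ x| ≤ 1) → (∀ w, |g w| ≤ κ) → Orthogonal g →
      ∀ ε : ℝ, 0 < ε → ∃ τ : ℝ, 0 < τ ∧ ∃ N₀ : ℕ, ∀ N : ℕ, N₀ ≤ N → ∀ Φ : Flow σ N,
        klDiv (tiltedGibbs σ a θ u₀ φ g τ N Φ) (gibbs σ a θ u₀ N Φ) ≤
          ENNReal.ofReal (ε * ((N + 1 : ℕ) : ℝ))

/-- Statement of `stub_secondMomentBudget` — **finite entropy budgets the second velocity moment of the reduced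
one-body law**: there is an absolute constant `c₂ ≥ 0` such that in the crux frame (`a, θ > 0`, `σ ≤ 1/2`), for every
probability law `ν` with `KL(ν ‖ G_N) < ∞`, every time `t`, every flow and every `N`,
`∫⁻ ‖w‖² df_t ≤ c₂ + 4·KL(ν ‖ G_N)/(N+1)`.
Proof plan: as `stub_firstMomentBudget` (p150392) with the one-body Donsker–Varadhan tests
`g_n(x, w) = min(‖w‖², n)/4 − log Z_n`, `Z_n = ∫ e^{min(‖w‖², n)/4} dγ ≤ Z_∞ = ∫ e^{‖w‖²/4} dγ < ∞`
(`IsGaussian.exists_integrable_exp_sq`, or the closed form `2^{3/2}`); `c₂ = 4 log Z_∞`; monotone convergence. -/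
def SecondMomentBudget : Prop :=
  ∃ c₂ : ℝ, 0 ≤ c₂ ∧ ∀ (σ a θ : ℝ) (u₀ : V3) (N : ℕ) (Φ : Flow σ N) (ν : Measure (Phase N)),
    IsProbabilityMeasure ν → 0 < a → 0 < θ → σ ≤ 1 / 2 →
    klDiv ν (gibbs σ a θ u₀ N Φ) ≠ ⊤ → ∀ t : ℝ,
      ∫⁻ y, ‖y.2‖ₑ ^ 2 ∂(oneBodyLaw θ u₀ Φ ν t) ≤
        ENNReal.ofReal (c₂ + 4 * (klDiv ν (gibbs σ a θ u₀ N Φ)).toReal / ((N + 1 : ℕ) : ℝ))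

/-- Statement of `stub_productionContinuity` — **the cut Hellinger production is continuous at the local Maxwellian
in the entropy + second-moment topology**: for every cut level `K ≥ 0`, second-moment bound `M ≥ 0` and `ε > 0` there is
`η > 0` such that every one-body probability law `f ≪ m = vol ⊗ γ` on `𝕋³ × ℝ³` with `∫ ‖w‖² df ≤ M` and velocity
relative entropy `KL(f ‖ f₁ ⊗ γ) ≤ η` has cut production `𝒟(1_{n ≤ K} · df/dm) ≤ ε` (`n = d f₁/d vol`; the cut
expression is literally `cutDensity` at a reduced one-body law, `stub_hTheoremObjectsD`).
Proof plan (fibrewise, `ρ = df/dm`, `n(x) = ∫ ρ(x, ·) dγ`, `ζ = √ρ − √n`): Hellinger defect²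
`≤ 2(√(ρ'ρ'_*) − n)² + 2(√(ρρ_*) − n)²`, the gain half equals the loss half by the collision involution (as in
`CutProductionLeMoment`, p151339), `(√(ρρ_*) − n)² ≤ 2ζ²ρ_* + 2nζ_*²`, `B ≤ ‖v‖ + ‖v_*‖`, so a kept fibre produces
`≤ 8|S²| [2n ∫‖v‖ζ² dγ + (∫ζ² dγ)(∫‖w‖ρ dγ + n m_γ)]`; truncate `‖v‖ ≤ R` (`ζ² ≤ ρ + n` above `R`, second-moment tails
`≤ M/R`, Gaussian tail), use `n ≤ K`, `∫∫ ζ² dγ dx ≤ KL(f ‖ f₁ ⊗ γ)` (`lintegral_sqrt_rnDeriv_sub_sqrt_fst_sq_le_klDiv`),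
and split the fibres at `∫ ζ² dγ ≤ λ n` (mass of the others `≤ KL/λ`). -/
def ProductionContinuity : Prop :=
  ∀ K : ℝ, 0 ≤ K → ∀ M : ℝ, 0 ≤ M → ∀ ε : ℝ, 0 < ε → ∃ η : ℝ, 0 < η ∧
    ∀ f : Measure (T3 × V3), IsProbabilityMeasure f → f ≪ refMeasure →
      ∫⁻ y, ‖y.2‖ₑ ^ 2 ∂f ≤ ENNReal.ofReal M → velKL f ≤ ENNReal.ofReal η →
      production (Set.indicator ({x | (f.fst.rnDeriv volume x).toReal ≤ K} ×ˢ Set.univ)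
          (fun y => (f.rnDeriv refMeasure y).toReal)) ≤ ENNReal.ofReal ε

/-! ### Bookkeeping sub-goal of part E: the old core implies the new -/

/-- Statement of the bookkeeping sub-goal `stub_hTheoremObjectsE`: **a rate `B/τ` is in particular smallness at some
window** — `LargeWindowDissipationTilt → VanishingWindowDissipationTilt` (take any `τ > max(τ₀, 0) + B/η`). -/
def HTheoremObjectsEBasic : Prop :=
  LargeWindowDissipationTilt → VanishingWindowDissipationTilt

/-- **Bookkeeping sub-goal of part E** (`stub_hTheoremObjectsE`): the core of reshape 3 implies the core of reshape 4. -/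
theorem stub_hTheoremObjectsE : HTheoremObjectsEBasic := by
  intro hL a θ u₀ ha hθ
  obtain ⟨σ₀, hσ₀, H⟩ := hL a θ u₀ ha hθ
  refine ⟨σ₀, hσ₀, fun σ hσ hσlt => ?_⟩
  obtain ⟨κb, hκb, H'⟩ := H σ hσ hσlt
  refine ⟨κb, hκb, fun φ g hφ hg hφ1 hgκ horth K hK η hη => ?_⟩
  obtain ⟨τ₀, B, hB, H''⟩ := H' φ g hφ hg hφ1 hgκ horth K hK
  set τ : ℝ := max τ₀ 0 + B / η + 1 with hτdef
  have hBη : 0 ≤ B / η := div_nonneg hB hη.le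
  have hτ0 : 0 < τ := by
    have : 0 ≤ max τ₀ 0 := le_max_right _ _
    linarith
  have hτ₀ : τ₀ < τ := by
    have : τ₀ ≤ max τ₀ 0 := le_max_left _ _
    linarith
  have hBτ : B / τ ≤ η := by
    rw [div_le_iff₀ hτ0]
    have h1 : B / η < τ := by
      have : 0 ≤ max τ₀ 0 := le_max_right _ _
      linarith
    have h2 : B = η * (B / η) := by field_simp
    rw [h2]
    exact mul_le_mul_of_nonneg_left h1.le hη.le
  obtain ⟨N₀, hN⟩ := H'' τ hτ₀
  refine ⟨τ, hτ0, N₀, fun N hNN Φ => (hN N hNN Φ).trans (ENNReal.ofReal_le_ofReal ?_)⟩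
  have hw : 0 ≤ window τ N := (mul_pos hτ0 (Real.rpow_pos_of_pos (by positivity) _)).le
  calc window τ N / τ * B = (B / τ) * window τ N := by ring
    _ ≤ η * window τ N := mul_le_mul_of_nonneg_right hBτ hw

end Summit.AtomisticToContinuum.HydrodynamicLimit.Theorems.HTheorem

end
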